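/-
Copyright (c) 2026 the pub-hodgecm-mathlib formalisation cell (harness21).  Prover seat hodgecm-mathlib-LH4-p11 (g9), req620 Track A «(D-RAM) FOUR-FRAME» squad, helper lane on
h413 = stmt-HodgeConjecture-24833 (count-neutral).  β-BOARD v1 ROW R6a «THE κ-CLASS OF TOWER 1», FILE E1: the orbit kit of the κ-branch — representatives, decomposition, and the
slot-`2` per-orbit value in closed form (β chair F0P3a-p01 (g37) LEDGER #18 `hκ₁`).  2026-09-04.
-/
import Summits.HodgeConjecture.HodgeConjecture.Theorems.F0P3cDyRamLabelledOddKappaClassValueG1Slots   -- ★ p861894 (this seat, FILE C): slots 0∕1 closed; brings ★ p861844 FILE B, ★ p861745 FILE A, `kappaChar_tokens`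
import Summits.HodgeConjecture.HodgeConjecture.Theorems.F0P3cDyRamLabelledOddKappaClassSlotTwoG1      -- ★ FILE D (this seat): `forall_normSign_two_mul_kappaChar_iff`
import Summits.HodgeConjecture.HodgeConjecture.Theorems.F0P3cDyRamLabelledOddOffFootShellG1          -- ★ p861967 (this seat): `shell_iff_of_mem_stratum_G1_offFoot`; brings ★ `stratum_G1_eq`
import Summits.HodgeConjecture.HodgeConjecture.Theorems.F0P3cDyRamLabelledOddBoundaryG1Orbits         -- ★ p861907 (LH4-p17 (g0)): the R3 orbit kit (template); brings ★ LH7-p05 decomposition, ★ `latticeInLevel_diagonal_mapGL_iff`, ★ orbit finiteness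
import HarnessLib

/-!
# Crux `H413`, line LH4 «(D-RAM) FOUR-FRAME» — (β-BAL) Stage B, β-BOARD ROW R6a (tower 1), FILE E1: THE ORBIT KIT OF THE κ-BRANCH OF `G₁ = (2ρ, 2ρ+s, 2ρ+s)`

Cell `hodgecm-mathlib` (D-0151), FLOOR 0, crux item H413 = `stmt-HodgeConjecture-24833`, route `HCCMUnconditional`; squad F0∕P3c∕LH4.  THEOREMS ONLY (no `def`, no instance, no
notation, no `sorry`, default heartbeats); ★-only imports; lane `--supports stmt-HodgeConjecture-24833 --as helper` (count-neutral); pays NO row, states NO law.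

WHAT (the κ-branch of tower 1: `2ρ + ℓ₀ = n₂`, `2ρ + s + ℓ₀ < n₁`, `s = 2t′`; `ℓ₀ = d % 2`).  The orbit kit of the tower-1 κ-class stratum head `hκ₁` (β chair LEDGER #18), mirroring
LH4-p17 (g0)'s ★ p861907 R3 kit beyond the cell:
* §1 `latt_glued_rep_mem_stratum_kappaLocus`: every representative `latt V(1,1,g)` (`g` fixed, `|g| = |ϖ|^{2t′}`) is `T`-stable and in the stratum `(2ρ, 2ρ+2t′, 2ρ+2t′)`
  (★ `mapGL_latt_glued_rep_of_depths` on the tube `2ρ + 2t′ ≤ n₁`, `2ρ ≤ n₂`, `ρ ≤ n₃`; ★ `stratum_G1_eq`, ★ κG-A1's polarisation).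
* §2 `finsum_kappaLocus_eq_card_mul_sum`: on the κ-branch the clean-shell cut is the whole stratum (★ p861967's dictionary, κ-disjunct), so the labelled table over the cut is
  `|𝒯-orbit| · Σ_{g ∈ R}` of the per-representative values for any complete irredundant system `R` of the orbit parameters (★ LH7-p05 `finsum_labelledOdd_div_relIndex_glued_sep_eq`).
* §3 `labelledOddCount_div_relIndex_glued_rep_kappaLocus_two`: the slot-`2` per-orbit value in CLOSED FORM, `= ω(g·e_A·(1+r))·ω(−1)ω(1+g)∕2 · [2d ≤ ρ + 1] · w`
  (★ p861844 FILE B at `i = 2`, the slot-2 indicator ★ FILE D, `ω(D(g)₂) = ω(−π₀^{−(ρ+t′)}(1+g)⁻¹) = ω(−1)·ω(1+g)`), completing ★ p861894's slots `0` and `1`.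
HONEST LABEL.  Count-neutral (`--supports`); nothing printed is asserted; `hκ₁`, hRest, (β) `stub_law_cleanSgn`, T₊ remain OPEN; `HC_CM` is proved only modulo the 7 printed citations
(2 remaining named inputs: hLiu418 = `stmt-HodgeConjecture-24832`, h413 = `stmt-HodgeConjecture-24833`) until rung 0 closes.
References: [Kottwitz1986BaseChangeUnits] §1 pp. 240–241 · [Rogawski1990] §4.9 Prop. 4.9.1 (a)(b) p. 55, §4.10 p. 58 · [LanglandsShelstad1987] §3 · [Serre1979] Ch. V §3 Cor. 3, Ch. XV §2.
-/

set_option autoImplicit false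

noncomputable section

namespace Summit.HodgeConjecture.HodgeConjecture.Cruxes.H413.F0P3cDyRamLabelledOddKappaClassG1Orbits

open Matrix WithZero
open Literature.NumberTheory.Automorphic Literature.NumberTheory.Automorphic.HermitianLattice Literature.NumberTheory.Automorphic.UnitaryGroup
open Literature.NumberTheory.Automorphic.UnitaryLatticeTree Literature.NumberTheory.Automorphic.UnitaryThreeFourFrame
open Literature.NumberTheory.LocalFields Literature.NumberTheory.LocalFields.WildQuadraticDatum
open Summit.HodgeConjecture.HodgeConjecture.Cruxes.H413.F0P3cDyRamFourFramePieces
open Summit.HodgeConjecture.HodgeConjecture.Cruxes.H413.F0P3cDyRamFourFrameCensusDefs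
open Summit.HodgeConjecture.HodgeConjecture.Cruxes.H413.F0P3cDyRamStageOneBDefs (mcOfRecord)
open Summit.HodgeConjecture.HodgeConjecture.Cruxes.H413.F0P3cDyRamDiagonalTorusDefs
open Summit.HodgeConjecture.HodgeConjecture.Cruxes.H413.F0P3cDyRamDiagonalStrataDefs
open Summit.HodgeConjecture.HodgeConjecture.Cruxes.H413.F0P3cDyRamDiagonalKappaCountDefs
open Summit.HodgeConjecture.HodgeConjecture.Cruxes.H413.F0P3cDyRamLabelledOddCountDefs
open Summit.HodgeConjecture.HodgeConjecture.Cruxes.H413.F0P3cDyRamDiagonalGluedStratum (stratum_G1_eq)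
open Summit.HodgeConjecture.HodgeConjecture.Cruxes.H413.F0P3cDyRamStableCountTypeZero (v_diag_eq_one diag_regular)
open Summit.HodgeConjecture.HodgeConjecture.Cruxes.H413.F0P3cDyRamDiagonalOrbitFibreCountHeads (finite_unitTorus_orbit_of_mem_normalisedStableLattices)
open Summit.HodgeConjecture.HodgeConjecture.Cruxes.H413.F0P3cDyRamDiagonalGluedStabiliserIndex (ne_zero_and_v_lt_one_of_v_eq_exp)
open Summit.HodgeConjecture.HodgeConjecture.Cruxes.H413.F0P3cDyRamDiagonalKappaGluedDecomposition (mapGL_latt_glued_rep_of_depths)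
open Summit.HodgeConjecture.HodgeConjecture.Cruxes.H413.F0P3cDyRamDiagonalKappaGluedClassForm (isVertexLattice_zero_latt_glued_rep)
open Summit.HodgeConjecture.HodgeConjecture.Cruxes.H413.F0P3cDyRamLabelledOddGluedDecomposition (finsum_labelledOdd_div_relIndex_glued_sep_eq)
open Summit.HodgeConjecture.HodgeConjecture.Cruxes.H413.F0P3cDyRamValueClassLabelEquivariant (isTorusEquivariantLabel_valueClassLabel)
open Summit.HodgeConjecture.HodgeConjecture.Cruxes.H413.F0P3cDyRamLevelCountDiagonalModel (latticeInLevel_diagonal_mapGL_iff)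
open Summit.HodgeConjecture.HodgeConjecture.Cruxes.H413.F0P3cDyRamFixedCountDiagonalModel (normSign_mul_norm)
open Summit.HodgeConjecture.HodgeConjecture.Cruxes.H413.F0P3cDyRamLabelledOddOffFootShellG1 (shell_iff_of_mem_stratum_G1_offFoot)
open Summit.HodgeConjecture.HodgeConjecture.Cruxes.H413.F0P3cDyRamLabelledOddKappaClassValueG1 (labelledOddCount_div_relIndex_glued_rep_kappaLocus)
open Summit.HodgeConjecture.HodgeConjecture.Cruxes.H413.F0P3cDyRamLabelledOddKappaClassValueG1Slots (kappaChar_tokens)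
open Summit.HodgeConjecture.HodgeConjecture.Cruxes.H413.F0P3cDyRamLabelledOddKappaClassSlotTwoG1 (forall_normSign_two_mul_kappaChar_iff)
open scoped Valued WithZero Matrix MatrixGroups

variable {K : Type} [Field K] [Valued K ℤᵐ⁰] [CompleteSpace K] [Fintype 𝓀[K]] {σ : K →+* K} {ϖ : K} {d t : ℕ} {α β : K} {N₀ n₁ n₂ n₃ : ℕ}

/-! ## §1  On the κ-branch every representative is `T`-stable and lies in the stratum -/

omit [CompleteSpace K] [Fintype 𝓀[K]] in
/-- **EVERY REPRESENTATIVE `latt V(1,1,g)` IS `T`-STABLE AND IN THE STRATUM** on the κ-branch of tower 1 (`2ρ + ℓ₀ = n₂`, `2ρ + 2t′ + ℓ₀ < n₁`): the tube inequalities `2ρ + 2t′ ≤ n₁`,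
`2ρ ≤ n₂`, `ρ ≤ n₃` hold (`n₃ ≥ min n₁ n₂`), so ★ `mapGL_latt_glued_rep_of_depths` gives stability; dualisability by ★ κG-A1's explicit polarisation; ★ `stratum_G1_eq`.
[cite: Kottwitz1986BaseChangeUnits, §1 pp. 240–241] -/
theorem latt_glued_rep_mem_stratum_kappaLocus (hD : IsRamifiedQuadraticDatum σ ϖ d t) (hE : IsElementDatum σ ϖ N₀ α β n₁ n₂ n₃)
    (T : GL (Fin 3) K) (hT : (T : Matrix (Fin 3) (Fin 3) K) = Matrix.diagonal ![α, β, 1]) (ρ t' : ℕ) (hρ : 1 ≤ ρ) (ht' : 1 ≤ t')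
    (hloc : 2 * ρ + d % 2 = n₂) (hgt : 2 * ρ + 2 * t' + d % 2 < n₁)
    {g : K} (hσg : σ g = g) (hg : Valued.v g = Valued.v ϖ ^ (2 * t'))
    (V : GL (Fin 3) K) (hV : (V : Matrix (Fin 3) (Fin 3) K) = !![1, 0, 0; 1, ϖ ^ ρ, 0; 1 * 1 + g, ϖ ^ ρ * 1, ϖ ^ (2 * ρ + 2 * t')]) :
    mapGL T (latt (V : Matrix (Fin 3) (Fin 3) K)) = latt (V : Matrix (Fin 3) (Fin 3) K) ∧
      latt (V : Matrix (Fin 3) (Fin 3) K) ∈ stratum σ ϖ T ![2 * ρ, 2 * ρ + 2 * t', 2 * ρ + 2 * t'] := by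
  obtain ⟨hσ, hvσ, hϖ, hfix, -, -, -⟩ := id hD
  obtain ⟨hϖ0, hϖ1⟩ := ne_zero_and_v_lt_one_of_v_eq_exp hϖ
  have hvϖ : 0 < Valued.v ϖ := (Valuation.pos_iff _).2 hϖ0
  have hσϖ0 : σ ϖ ≠ 0 := (map_ne_zero σ).2 hϖ0
  obtain ⟨hαn, hβn, -, -, -, h₁, h₂, h₃, -, -, -⟩ := id hE
  have hαv := UnitaryThreeFourFrame.v_eq_one_of_mul_map_eq_one hvσ hαn
  have hβv := UnitaryThreeFourFrame.v_eq_one_of_mul_map_eq_one hvσ hβn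
  have h₃' : Valued.v (β - α) = Valued.v ϖ ^ n₃ := by rw [Valuation.map_sub_swap, h₃]
  obtain ⟨hi1, -, -⟩ := isoceles_depths hϖ h₁ h₂ h₃
  have hstab : mapGL T (latt (V : Matrix (Fin 3) (Fin 3) K)) = latt (V : Matrix (Fin 3) (Fin 3) K) :=
    mapGL_latt_glued_rep_of_depths hϖ0 hϖ1.le hαv hβv T hT h₁ h₂ h₃' (by omega) (by omega)
      (le_trans (by omega : ρ ≤ min n₁ n₂) hi1) hg V hV
  refine ⟨hstab, ?_⟩
  rw [stratum_G1_eq hvσ hfix hϖ T hρ (by omega : 1 ≤ 2 * t')]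
  refine ⟨1, 1, g, by simp, by simp, hg, by rw [hV], hstab, ?_⟩
  have hπ0 : ((ϖ * σ ϖ) ^ (ρ + t') : K) ≠ 0 := pow_ne_zero _ (mul_ne_zero hϖ0 hσϖ0)
  have hσπ : σ ((ϖ * σ ϖ) ^ (ρ + t')) = (ϖ * σ ϖ) ^ (ρ + t') := by rw [map_pow, map_mul, hσ, mul_comm]
  have hg0 : g ≠ 0 := fun h => by rw [h, map_zero] at hg; exact (pow_ne_zero _ hvϖ.ne') hg.symm
  have h1g : Valued.v (1 + g) = 1 := Valued.v.map_one_add_of_lt (by rw [hg]; exact pow_lt_one₀ zero_le hϖ1 (by omega))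
  have h1g0 : (1 : K) + g ≠ 0 := fun h => by rw [h, map_zero] at h1g; exact zero_ne_one h1g
  have hσ1g : σ (1 + g) = 1 + g := by rw [map_add, map_one, hσg]
  refine ⟨![((ϖ * σ ϖ) ^ (ρ + t'))⁻¹ * g, ((ϖ * σ ϖ) ^ (ρ + t'))⁻¹, -(((ϖ * σ ϖ) ^ (ρ + t'))⁻¹ * (1 + g)⁻¹)], fun k => ?_,
    isVertexLattice_zero_latt_glued_rep hσ hvσ hϖ0 hϖ1 ρ t' hσg hg ht' V hV⟩
  fin_cases k
  · simp only [Fin.zero_eta, Fin.isValue, Matrix.cons_val_zero]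
    exact ⟨by rw [map_mul, map_inv₀, hσπ, hσg], mul_ne_zero (inv_ne_zero hπ0) hg0⟩
  · simp only [Fin.mk_one, Fin.isValue, Matrix.cons_val_one, Matrix.cons_val_zero]
    exact ⟨by rw [map_inv₀, hσπ], inv_ne_zero hπ0⟩
  · simp only [Fin.reduceFinMk, Matrix.cons_val_two, Matrix.tail_cons, Matrix.head_cons]
    exact ⟨by rw [map_neg, map_mul, map_inv₀, map_inv₀, hσπ, hσ1g], neg_ne_zero.2 (mul_ne_zero (inv_ne_zero hπ0) (inv_ne_zero h1g0))⟩

/-! ## §2  The decomposition of the κ-class table over the representatives -/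

omit [CompleteSpace K] in
/-- **THE TABLE OF THE κ-CLASS, OVER THE REPRESENTATIVES**: on the κ-branch of tower 1, for any complete irredundant system `R` of the orbit parameters and reference frames
`V₀ g = V(1,1,g)`, `Σᶠ_{M ∈ stratum, shell} m^Λ_i(M)∕[𝒰:N(S̃′(M))] = |𝒯-orbit| · Σ_{g ∈ R} m^Λ_i(latt V₀ g)∕[𝒰:N(S̃′(latt V₀ g))]` (★ `stratum_G1_eq` ∘ ★ LH7-p05
`finsum_labelledOdd_div_relIndex_glued_sep_eq`; every representative is stable (§1) and on the clean shell — ★ p861967's dictionary, κ-disjunct).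
[cite: Kottwitz1986BaseChangeUnits, §1 pp. 240–241] [cite: Rogawski1990, §4.9 Prop. 4.9.1 (a) p. 55] -/
theorem finsum_kappaLocus_eq_card_mul_sum (h2 : Valued.v (2 : K) < 1) (hD : IsRamifiedQuadraticDatum σ ϖ d t)
    (hE : IsElementDatum σ ϖ N₀ α β n₁ n₂ n₃) (hmc : mcOfRecord d ≤ N₀)
    (T : GL (Fin 3) K) (hT : (T : Matrix (Fin 3) (Fin 3) K) = Matrix.diagonal ![α, β, 1]) (ρ t' : ℕ) (hρ : 1 ≤ ρ) (ht' : 1 ≤ t')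
    (hloc : 2 * ρ + d % 2 = n₂) (hgt : 2 * ρ + 2 * t' + d % 2 < n₁)
    (R : Finset K) (hR1' : ∀ g ∈ R, σ g = g ∧ Valued.v g = Valued.v ϖ ^ (2 * t'))
    (hR2' : ∀ f : K, σ f = f → Valued.v f = Valued.v ϖ ^ (2 * t') → ∃ g ∈ R, Valued.v (f - g) ≤ Valued.v ϖ ^ (ρ + 2 * t'))
    (hR3' : ∀ g ∈ R, ∀ g' ∈ R, Valued.v (g - g') ≤ Valued.v ϖ ^ (ρ + 2 * t') → g = g')
    (V₀ : K → GL (Fin 3) K) (hV₀ : ∀ g, (V₀ g : Matrix (Fin 3) (Fin 3) K) = !![1, 0, 0; 1, ϖ ^ ρ, 0; 1 * 1 + g, ϖ ^ ρ * 1, ϖ ^ (2 * ρ + 2 * t')])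
    (m : ℕ) (i : Fin 3) :
    ∑ᶠ M ∈ {M : Submodule 𝒪[K] (Fin 3 → K) | M ∈ stratum σ ϖ T ![2 * ρ, 2 * ρ + 2 * t', 2 * ρ + 2 * t'] ∧
        (LatticeInLevel ϖ (d % 2) (Matrix.diagonal ![α - 1, β - 1, 0]) M ∧ ¬ LatticeInLevel ϖ (d % 2 + 1) (Matrix.diagonal ![α - 1, β - 1, 0]) M ∧
          LatticeInLevel ϖ (mcOfRecord d) (Matrix.diagonal ![(α - 1) * (α - 1), (β - 1) * (β - 1), 0]) M)},
      (labelledOddCount σ ϖ 0 i (valueClassLabel σ ϖ (α - 1) (β - 1) m d) M : ℚ) /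
        ((((unitStabilizer M).map (unitNormMap σ 3)).relIndex (fixedUnitTorus σ 3) : ℕ) : ℚ) =
      ((((Nat.card 𝓀[K] - 1) * Nat.card 𝓀[K] ^ (ρ + 2 * t' - 1)) * ((Nat.card 𝓀[K] - 1) * Nat.card 𝓀[K] ^ (2 * ρ - 1)) : ℕ) : ℚ) *
        ∑ g ∈ R, (labelledOddCount σ ϖ 0 i (valueClassLabel σ ϖ (α - 1) (β - 1) m d) (latt (V₀ g : Matrix (Fin 3) (Fin 3) K)) : ℚ) /
            ((((unitStabilizer (latt (V₀ g : Matrix (Fin 3) (Fin 3) K))).map (unitNormMap σ 3)).relIndex (fixedUnitTorus σ 3) : ℕ) : ℚ) := by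
  classical
  haveI : Finite 𝓀[K] := Finite.of_fintype _
  have hTr := trace_bound_of_isRamifiedQuadraticDatum hD h2
  obtain ⟨hσ, hvσ, hϖ, hfix, -, -, -⟩ := id hD
  have hs : 1 ≤ 2 * t' := by omega
  have hP : ∀ u ∈ unitTorus K 3, ∀ M : Submodule 𝒪[K] (Fin 3 → K),
      (LatticeInLevel ϖ (d % 2) (Matrix.diagonal ![α - 1, β - 1, 0]) (mapGL (diagGLUnits u) M) ∧
          ¬ LatticeInLevel ϖ (d % 2 + 1) (Matrix.diagonal ![α - 1, β - 1, 0]) (mapGL (diagGLUnits u) M) ∧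
            LatticeInLevel ϖ (mcOfRecord d) (Matrix.diagonal ![(α - 1) * (α - 1), (β - 1) * (β - 1), 0]) (mapGL (diagGLUnits u) M)) ↔
        (LatticeInLevel ϖ (d % 2) (Matrix.diagonal ![α - 1, β - 1, 0]) M ∧ ¬ LatticeInLevel ϖ (d % 2 + 1) (Matrix.diagonal ![α - 1, β - 1, 0]) M ∧
          LatticeInLevel ϖ (mcOfRecord d) (Matrix.diagonal ![(α - 1) * (α - 1), (β - 1) * (β - 1), 0]) M) := fun u _ M => by
    rw [latticeInLevel_diagonal_mapGL_iff (coe_diagGLUnits u), latticeInLevel_diagonal_mapGL_iff (coe_diagGLUnits u),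
      latticeInLevel_diagonal_mapGL_iff (coe_diagGLUnits u)]
  rw [stratum_G1_eq hvσ hfix hϖ T hρ hs,
    finsum_labelledOdd_div_relIndex_glued_sep_eq hσ hvσ hϖ hTr T hT ρ t' hρ ht' R hR1' hR2' hR3' V₀ hV₀ 0 i
      (isTorusEquivariantLabel_valueClassLabel σ ϖ (α - 1) (β - 1) m d) _ hP,
    Finset.sum_filter, Finset.sum_congr rfl (fun g hg => by
      obtain ⟨hstab, hmem⟩ := latt_glued_rep_mem_stratum_kappaLocus hD hE T hT ρ t' hρ ht' hloc hgt (hR1' g hg).1 (hR1' g hg).2 (V₀ g) (hV₀ g)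
      rw [if_pos ⟨hstab, (shell_iff_of_mem_stratum_G1_offFoot hD hE hmc T ρ (2 * t') hρ hs (by omega) _ hmem).2 (Or.inr ⟨hloc, hgt⟩)⟩])]

/-! ## §3  The slot-`2` per-orbit value in closed form -/

open Classical in
/-- **SLOT `2`, CLOSED FORM**: on the κ-locus glued representative `latt V(1,1,g)` (hypotheses of ★ FILE B's head, plus `|2| < 1` for the killer),
`labelledOddCount σ ϖ 0 2 Λ (latt V) ∕ [𝒰 : N(S̃′)] = ω(g·e_A·(1 + r))·(ω(−1)·ω(1+g))∕2 · [2d ≤ ρ + 1] · stabiliserWeight σ (latt V)`, `r = e_B·π₀^{t′+k}∕(g·e_A)` — ★ FILE B at `i = 2`,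
the slot-2 indicator ★ FILE D (`|c| = |ϖ|^{2k} ≤ |ϖ|^{2k}`), and `ω(D(g)₂) = ω(−π₀^{−(ρ+t′)}·(1+g)⁻¹) = ω(−1)·ω(1+g)` (`π₀^{−(ρ+t′)}` a norm, `ω((1+g)⁻¹) = ω(1+g)`).
[cite: Kottwitz1986BaseChangeUnits, §1 pp. 240–241] [cite: LanglandsShelstad1987, §3] [cite: Serre1979, Ch. V §3 Cor. 3; Ch. XV §2] [cite: Rogawski1990, §4.9 Prop. 4.9.1 (b) p. 55, §4.10 p. 58] -/
theorem labelledOddCount_div_relIndex_glued_rep_kappaLocus_two (hD : IsRamifiedQuadraticDatum σ ϖ d t) (h2 : Valued.v (2 : K) < 1) (h2d : 2 ≤ d)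
    (hE : IsElementDatum σ ϖ N₀ α β n₁ n₂ n₃) (hmc : mcOfRecord d ≤ N₀)
    {T : GL (Fin 3) K} (hT : (T : Matrix (Fin 3) (Fin 3) K) = Matrix.diagonal ![α, β, 1])
    {ρ t' : ℕ} (hρ : 1 ≤ ρ) (ht' : 1 ≤ t') {g : K} (hσg : σ g = g) (hg : Valued.v g = Valued.v ϖ ^ (2 * t'))
    (V : GL (Fin 3) K) (hV : (V : Matrix (Fin 3) (Fin 3) K) = !![1, 0, 0; 1, ϖ ^ ρ, 0; 1 * 1 + g, ϖ ^ ρ * 1, ϖ ^ (2 * ρ + 2 * t')])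
    (hn : IsNormalisedLattice (latt (V : Matrix (Fin 3) (Fin 3) K)))
    (hTM : mapGL T (latt (V : Matrix (Fin 3) (Fin 3) K)) = latt (V : Matrix (Fin 3) (Fin 3) K))
    (hlev : LatticeInLevel ϖ (d % 2) (Matrix.diagonal ![α - 1, β - 1, 0]) (latt (V : Matrix (Fin 3) (Fin 3) K)))
    (hnlev : ¬ LatticeInLevel ϖ (d % 2 + 1) (Matrix.diagonal ![α - 1, β - 1, 0]) (latt (V : Matrix (Fin 3) (Fin 3) K)))
    (hsq : LatticeInLevel ϖ (mcOfRecord d) (Matrix.diagonal ![(α - 1) * (α - 1), (β - 1) * (β - 1), 0]) (latt (V : Matrix (Fin 3) (Fin 3) K)))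
    (hfin : {M : Submodule 𝒪[K] (Fin 3 → K) | ∃ u ∈ unitTorus K 3, M = mapGL (diagGLUnits u) (latt (V : Matrix (Fin 3) (Fin 3) K))}.Finite)
    (hκ : 2 * ρ + d % 2 = n₂) (k : ℕ) (hk : 1 ≤ k) (hk₁ : 2 * (ρ + t' + k) + d % 2 = n₁)
    {eA : K} (hσeA : σ eA = eA) (heA1 : Valued.v eA = 1)
    (heA : Valued.v ((ϖ ^ (d % 2 + 2 * d - 1))⁻¹ * ((α - 1) * ((ϖ * σ ϖ) ^ ρ)⁻¹ - eA * ((ϖ - σ ϖ) * ((ϖ * σ ϖ) ^ ((d - d % 2) / 2))⁻¹))) ≤ 1)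
    {eB : K} (hσeB : σ eB = eB) (heB1 : Valued.v eB = 1)
    (heB : Valued.v ((ϖ ^ (d % 2 + 2 * d - 1))⁻¹ * ((β - 1) * ((ϖ * σ ϖ) ^ (ρ + t' + k))⁻¹ - eB * ((ϖ - σ ϖ) * ((ϖ * σ ϖ) ^ ((d - d % 2) / 2))⁻¹))) ≤ 1) :
    (labelledOddCount σ ϖ 0 2 (valueClassLabel σ ϖ (α - 1) (β - 1) (d % 2 + 2 * d - 1) d) (latt (V : Matrix (Fin 3) (Fin 3) K)) : ℚ) /
        ((((unitStabilizer (latt (V : Matrix (Fin 3) (Fin 3) K))).map (unitNormMap σ 3)).relIndex (fixedUnitTorus σ 3) : ℕ) : ℚ) =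
      (normSign σ (g * eA * (1 + eB * (ϖ * σ ϖ) ^ (t' + k) / (g * eA))) : ℚ) * ((normSign σ (-1 : K) : ℚ) * (normSign σ (1 + g) : ℚ)) / 2 *
        ((if 2 * d ≤ ρ + 1 then 1 else 0 : ℤ) : ℚ) * stabiliserWeight σ (latt (V : Matrix (Fin 3) (Fin 3) K)) := by
  haveI : Finite 𝓀[K] := Finite.of_fintype _
  obtain ⟨-, -, hϖ, -, -, -, -⟩ := id hD
  obtain ⟨hϖ0, hϖ1⟩ := ne_zero_and_v_lt_one_of_v_eq_exp hϖ
  have hvϖ : 0 < Valued.v ϖ := (Valuation.pos_iff _).2 hϖ0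
  have h1g : Valued.v (1 + g) = 1 := Valued.v.map_one_add_of_lt (by rw [hg]; exact pow_lt_one₀ zero_le hϖ1 (by omega))
  have h1g0 : (1 : K) + g ≠ 0 := fun h => by rw [h, map_zero] at h1g; exact zero_ne_one h1g
  have hσ1g : σ (1 + g) = 1 + g := by rw [map_add, map_one, hσg]
  obtain ⟨hσc, hcv, -, -, -⟩ := kappaChar_tokens (ρ := ρ) hD hσg hg k hk hσeA heA1 hσeB heB1
  have hind := forall_normSign_two_mul_kappaChar_iff hD h2 hρ ht' hσg hg V hV hσc (k := 2 * k) (by omega) hcv.le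
  have hω2 : normSign σ ((![((ϖ * σ ϖ) ^ (ρ + t'))⁻¹ * g, ((ϖ * σ ϖ) ^ (ρ + t'))⁻¹, -(((ϖ * σ ϖ) ^ (ρ + t'))⁻¹ * (1 + g)⁻¹)] : Fin 3 → K) 2) =
      normSign σ (-1 : K) * normSign σ (1 + g) := by
    show normSign σ (-(((ϖ * σ ϖ) ^ (ρ + t'))⁻¹ * (1 + g)⁻¹)) = normSign σ (-1 : K) * normSign σ (1 + g)
    rw [show -(((ϖ * σ ϖ) ^ (ρ + t'))⁻¹ * (1 + g)⁻¹) = (-1 * (1 + g)⁻¹) * ((ϖ ^ (ρ + t'))⁻¹ * σ ((ϖ ^ (ρ + t'))⁻¹)) by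
        rw [map_inv₀, map_pow, mul_pow]; ring,
      normSign_mul_norm σ _ (inv_ne_zero (pow_ne_zero _ hϖ0)),
      normSign_mul_of_fixed hD (by rw [map_neg, map_one]) (by rw [map_inv₀, hσ1g]) (neg_ne_zero.2 one_ne_zero) (inv_ne_zero h1g0),
      normSign_inv_of_map_eq σ hσ1g h1g0]
  rw [labelledOddCount_div_relIndex_glued_rep_kappaLocus hD h2d hE hmc hT hρ ht' hσg hg V hV hn hTM hlev hnlev hsq hfin hκ k hk hk₁ hσeA heA1 heA hσeB heB1 heB 2, hω2]
  by_cases hc : 2 * d ≤ ρ + 1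
  · rw [if_pos (hind.2 hc), if_pos hc]; push_cast; ring
  · rw [if_neg (fun h => hc (hind.1 h)), if_neg hc]; simp

end Summit.HodgeConjecture.HodgeConjecture.Cruxes.H413.F0P3cDyRamLabelledOddKappaClassG1Orbits

end
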